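import Mathlib
import Literature.NumberTheory.LFunctions.Zhang2022.Section16Eval1617Typed
import Literature.NumberTheory.LFunctions.Zhang2022.Section16ResidueEstimatesRel
import Literature.NumberTheory.LFunctions.Zhang2022.Section16ResidueDischargeRel
import HarnessLib


/-!
# Zhang (2022) §16 p. 95, `Z22:§16.u045` AS PRINTED from (16.12) + (16.16), with no size input on `𝔞`

Topic `Literature/NumberTheory/LFunctions/Zhang2022` (Landau–Siegel audit tree; verdict-neutral).
Y. Zhang, *Discrete mean estimates and the Landau–Siegel zero*, arXiv:2211.02515v1 (2022)
[Zhang2022LandauSiegel] — **an unrefereed manuscript under adjudication** (ZHANG-L discharge lane,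
G-row G-d49-1). DISCHARGE file (theorems only; no new definitions, no new facts); no statement about
Theorems 1–2 of the manuscript or about Landau–Siegel zeros is made or implied.

The deduction sentence `Z22:§16.u045` [Z22 p.95, tex L4682–L4685]:

> "This together with (16.16) and (16.12) yields `Φ₂(p) = −(𝔢₁ + 𝔢₂)𝔞p + o(p)`."

The tree's kernel edge `Skeleton.phi2p_eval_of_parts` (`Section16Endgame`) / `step16_u045_of`
(`Section16Eval1617Typed`) derives the typed node `Typed.Section16B.Step16_u045 c′` from
`Typed.Section16A.Eq16_12` (16.12), `Typed.Section16B.Eq16_16` (16.16) and the display u044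
(`ℛ₂*ℛ₂ⱼ = −1/L′ + O(𝓛⁻¹L′⁻¹)`, AS PRINTED) only under the EXTRA hypothesis `hsmall : 𝔞 = o(𝓛)`,
which the manuscript does not supply (GAP-LEDGER G-d49-1: with the printed u044 rate the residual is
`O(𝓛⁻¹𝔞p)`). With u044 at the rate the residue computation actually yields —
`ResidueValues.step16_u044_sharp`: `ℛ₂*ℛ₂ⱼ = −1/L′ + O(𝓛⁻⁶L′⁻¹)` (this file, §1) — the
residual is `O(𝓛⁻⁶𝔞p) = O(𝓛⁻²p)` by the tree's `Skeleton.frakA_le` (`𝔞 ≤ 16e⁹𝓛⁴`, from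
`|L′(1,χ)| ≤ 2e^{9/2}(1+𝓛)𝓛`), and the sentence holds AS PRINTED:

* `phi2p_eval_of_parts_sharp` — the generic edge of `Skeleton.phi2p_eval_of_parts` with `h44` at rate
  `C·𝓛⁻⁶·‖L′‖⁻¹` and NO `hsmall` (same algebra `Skeleton.endgame_core`, run with the per-`D` constants
  `C₂ := C𝓛⁻⁵`, `η := 16e⁹𝓛³`);
* **`step16_u045_of_eq16_12_eq16_16 : Eq16_12 c′ → Eq16_16 c′ → Step16_u045 c′`** — u045 from the two
  displays (16.12), (16.16) as typed, u043/u044♯ and Lemma 5.7 being theorems of the tree, with no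
  further input;
* `eval1617_of_eq16_2_eq16_12_eq16_16 : Eq16_2 c′ → Eq16_12 c′ → Eq16_16 c′ → Skeleton.Eval1617 c′` —
  (16.17) (absolute currency) from the §16 displays as printed.

(The lane's chain of record reads (16.16)/(16.17) in relative / 𝔢-parametrised currency
(`Eq16_16R2E`, `Eval1617RelE`); this file concerns the printed sentence u045 itself.)

## References

* Y. Zhang, arXiv:2211.02515v1 (2022), §16 p. 95 (u043–u045, (16.12), (16.16), (16.17)), §2 (2.31).
  [cite: Zhang2022LandauSiegel, §16 p.95; §2 (2.31)]
-/

noncomputable section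

open Complex Real Filter Topology

/-! # §1. The display u044 at the computed rate `𝓛⁻⁶` -/

namespace Literature.NumberTheory.LFunctions.Zhang2022.ResidueValues

open Skeleton Typed.Section16A Typed.Section16B

variable (c' : ℝ)

/-! ## `ℛ₂*ℛ₂ⱼ = −L′(1,χ)⁻¹(1 + O(𝓛⁻⁶))`: the display u044 at the computed rate -/

/-- The algebra of the product: if `‖R* − b‖ ≤ C₀‖b‖x` and `‖bLR + 1‖ ≤ C_u x` (`b, L ≠ 0`,
`0 ≤ x ≤ 1`) then `‖R*R + 1/L‖ ≤ (C₀(1+C_u) + C_u)·x·‖L‖⁻¹`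
(`R*R + 1/L = (R* − b)R + (bLR + 1)/L`, `R = ((bLR+1) − 1)/(bL)`).
[cite: Zhang2022LandauSiegel, §16 p. 95] -/
theorem norm_rs_mul_r_add_inv_le {Rs R b L : ℂ} {C₀ Cu x : ℝ} (hb : b ≠ 0) (hL : L ≠ 0)
    (hC₀ : 0 ≤ C₀) (hCu : 0 ≤ Cu) (hx0 : 0 ≤ x) (hx1 : x ≤ 1)
    (hv : ‖Rs - b‖ ≤ C₀ * ‖b‖ * x) (hu : ‖b * L * R + 1‖ ≤ Cu * x) :
    ‖Rs * R + 1 / L‖ ≤ (C₀ * (1 + Cu) + Cu) * x * ‖L‖⁻¹ := by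
  have hbL : b * L ≠ 0 := mul_ne_zero hb hL
  have hb0 : 0 < ‖b‖ := norm_pos_iff.mpr hb
  have hL0 : 0 < ‖L‖ := norm_pos_iff.mpr hL
  set u : ℂ := b * L * R + 1 with hu_def
  have hR : R = (u - 1) / (b * L) := by rw [hu_def]; field_simp; ring
  have hid : Rs * R + 1 / L = (Rs - b) * R + u / L := by rw [hu_def]; field_simp; ring
  rw [hid]
  have hRn : ‖R‖ ≤ (Cu * x + 1) / (‖b‖ * ‖L‖) := by
    rw [hR, norm_div, norm_mul]
    gcongr
    calc ‖u - 1‖ ≤ ‖u‖ + ‖(1 : ℂ)‖ := norm_sub_le _ _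
      _ ≤ Cu * x + 1 := by rw [norm_one]; gcongr
  have h1 : ‖(Rs - b) * R‖ ≤ C₀ * (1 + Cu) * x * ‖L‖⁻¹ := by
    rw [norm_mul]
    calc ‖Rs - b‖ * ‖R‖ ≤ (C₀ * ‖b‖ * x) * ((Cu * x + 1) / (‖b‖ * ‖L‖)) :=
          mul_le_mul hv hRn (norm_nonneg _) (by positivity)
      _ = C₀ * (Cu * x + 1) * x * ‖L‖⁻¹ := by field_simp
      _ ≤ C₀ * (Cu * 1 + 1) * x * ‖L‖⁻¹ := by gcongr
      _ = C₀ * (1 + Cu) * x * ‖L‖⁻¹ := by ring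
  have h2 : ‖u / L‖ ≤ Cu * x * ‖L‖⁻¹ := by
    rw [norm_div, div_eq_mul_inv]
    gcongr
  calc ‖(Rs - b) * R + u / L‖ ≤ ‖(Rs - b) * R‖ + ‖u / L‖ := norm_add_le _ _
    _ ≤ C₀ * (1 + Cu) * x * ‖L‖⁻¹ + Cu * x * ‖L‖⁻¹ := add_le_add h1 h2
    _ = (C₀ * (1 + Cu) + Cu) * x * ‖L‖⁻¹ := by ring

/-- **`Z22:§16.u044` at the computed rate** (§16 p. 95, tex L4678–L4681, "so that
`ℛ₂*ℛ₂ⱼ = −1/L′(1,χ) + O(𝓛⁻¹L′(1,χ)⁻¹)`" — printed `𝓛⁻¹`; what the residue computation of u043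
yields is `𝓛⁻⁶`): for every `c′` there is `C` with, for all large `D` under (A) and `j = 1, 2`,
`‖ℛ₂*ℛ₂ⱼ + 1/L′(1,χ)‖ ≤ C·𝓛⁻⁶·‖L′(1,χ)‖⁻¹` (`ℛ₂* = Typed.Section16A.calR2star`,
`ℛ₂ⱼ = Typed.Section16A.calR2`). SHARPER than the typed node `Typed.Section16B.Step16_u044` (which it
implies for `𝓛 ≥ 1`); this is the repair "(a)" of GAP-LEDGER G-d49-1, under which u045 follows from
(16.12) + (16.16) with no size hypothesis on `𝔞`. [cite: Zhang2022LandauSiegel, §16 p. 95] -/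
theorem step16_u044_sharp :
    ∃ C : ℝ, ForAllLarge fun D _ χ => AssumptionA D χ → ∀ j ∈ ({1, 2} : Finset ℕ),
      ‖calR2star c' χ * calR2 c' χ j + 1 / deriv χ.LFunction 1‖ ≤
        C * (ell D ^ 6)⁻¹ * ‖deriv χ.LFunction 1‖⁻¹ := by
  obtain ⟨C₀, hC₀, h0⟩ := calR2star_rel_estimate c'
  obtain ⟨C₁, hC₁, h1⟩ := calR2_one_rel_estimate c'
  obtain ⟨C₂, hC₂, h2⟩ := calR2_two_rel_estimate c'
  obtain ⟨c, hc, h57⟩ := norm_deriv_LFunction_one_ge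
  obtain ⟨D₀, hall⟩ := ((h0.and h1).and h2).and h57
  set Cm : ℝ := max C₁ C₂ with hCm
  have hCm0 : 0 ≤ Cm := le_trans hC₁ (le_max_left _ _)
  refine ⟨C₀ * (1 + Cm) + Cm, max D₀ (max ⌈Real.exp 3⌉₊ ⌈Real.exp (14 * |c'| * π)⌉₊),
    fun D _ χ hD hq hp hA j hj => ?_⟩
  have hD₀ : D₀ ≤ D := le_trans (le_max_left _ _) hD
  obtain ⟨hL, he⟩ := thresholds c' (le_trans (le_max_right _ _) hD)
  have hℓ1 : 1 ≤ ell D := by linarith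
  obtain ⟨⟨⟨g0, g1⟩, g2⟩, g57⟩ := hall D χ hD₀ hq hp
  have hcL := g57 hA
  have hL0 : deriv χ.LFunction 1 ≠ 0 := by
    intro h; rw [h, norm_zero] at hcL; linarith
  obtain ⟨hβ1l, -, -⟩ := norm_beta_ge c' hL he
  have hα := alpha_pos hL
  have hβ1ne : beta1 c' D ≠ 0 := fun h => by rw [h, norm_zero] at hβ1l; linarith
  have hx0 : 0 ≤ (ell D ^ 6)⁻¹ := by positivity
  have hx1 : (ell D ^ 6)⁻¹ ≤ 1 := inv_le_one_of_one_le₀ (one_le_pow₀ hℓ1)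
  have hv := g0 hA
  simp only [Finset.mem_insert, Finset.mem_singleton] at hj
  rcases hj with rfl | rfl
  · have hu : ‖beta1 c' D * deriv χ.LFunction 1 * calR2 c' χ 1 + 1‖ ≤ Cm * (ell D ^ 6)⁻¹ :=
      (g1 hA).trans (mul_le_mul_of_nonneg_right (le_max_left _ _) hx0)
    exact norm_rs_mul_r_add_inv_le hβ1ne hL0 hC₀ hCm0 hx0 hx1 hv hu
  · have hu : ‖beta1 c' D * deriv χ.LFunction 1 * calR2 c' χ 2 + 1‖ ≤ Cm * (ell D ^ 6)⁻¹ :=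
      (g2 hA).trans (mul_le_mul_of_nonneg_right (le_max_right _ _) hx0)
    exact norm_rs_mul_r_add_inv_le hβ1ne hL0 hC₀ hCm0 hx0 hx1 hv hu

end Literature.NumberTheory.LFunctions.Zhang2022.ResidueValues

/-! # §2. u045 AS PRINTED -/

namespace Literature.NumberTheory.LFunctions.Zhang2022.Skeleton

/-- **§16 p. 95, u045 as a kernel edge for ANY `Φ₂(p)`, `𝓡₂*`, `𝓡₂ⱼ`, `𝒮₂ⱼ`, WITHOUT the size input
`𝔞 = o(𝓛)`**: if (16.12) holds with error `o(p)`, (16.16) with error `O(𝓛⁻⁴)`, and the product display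
u044 at the SHARP rate `‖𝓡₂*𝓡₂ⱼ + 1/L′‖ ≤ C𝓛⁻⁶‖L′‖⁻¹`, then `Φ₂(p) = −(𝔢₁+𝔢₂)𝔞p + o(p)`. The bound
at a large `D` is `(ε₁ + 8e(C₁C₂𝓛⁻⁵ + C₁)𝓛⁻¹ + C₂𝓛⁻⁵(|𝔢₁|+|𝔢₂|)·16e⁹𝓛³)p` (`Skeleton.endgame_core`
with `C₂𝓛⁻⁵` in the `C₂`-slot and `𝔞 ≤ (16e⁹𝓛³)·𝓛`, `Skeleton.frakA_le`; Lemma 5.7 of the tree gives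
`D/φ(D) ≤ 4e|L′(1,χ)|`). [cite: Zhang2022LandauSiegel, §16 p.95] -/
theorem phi2p_eval_of_parts_sharp
    (Φ : (D : ℕ) → [NeZero D] → DirichletCharacter ℂ D → ℕ → ℂ)
    (Rs : (D : ℕ) → [NeZero D] → DirichletCharacter ℂ D → ℂ)
    (R S : (D : ℕ) → [NeZero D] → DirichletCharacter ℂ D → ℕ → ℂ)
    (h1612 : ∀ ε : ℝ, 0 < ε → ForAllLarge fun D _ χ => AssumptionA D χ → ∀ p ∈ primeWindow D,
      ‖Φ D χ p - Rs D χ * ((D : ℝ) * p : ℝ) / (Nat.totient D : ℂ) *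
        ∑ j ∈ ({1, 2} : Finset ℕ), R D χ j * S D χ j‖ ≤ ε * p)
    (h1616 : ∃ C : ℝ, ForAllLarge fun D _ χ => AssumptionA D χ → ∀ j ∈ ({1, 2} : Finset ℕ),
      ‖S D χ j - (frakA χ : ℂ) * frake j * ((Nat.totient D : ℂ) / (D : ℂ)) * deriv χ.LFunction 1‖ ≤
        C * (ell D ^ 4)⁻¹)
    (h44 : ∃ C : ℝ, ForAllLarge fun D _ χ => AssumptionA D χ → ∀ j ∈ ({1, 2} : Finset ℕ),
      ‖Rs D χ * R D χ j + 1 / deriv χ.LFunction 1‖ ≤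
        C * (ell D ^ 6)⁻¹ * ‖deriv χ.LFunction 1‖⁻¹) :
    ∀ ε : ℝ, 0 < ε → ForAllLarge fun D _ χ => AssumptionA D χ → ∀ p ∈ primeWindow D,
      ‖Φ D χ p + (frake 1 + frake 2) * frakA χ * p‖ ≤ ε * p := by
  intro ε hε
  obtain ⟨C₁, hC₁⟩ := h1616
  obtain ⟨C₂, hC₂⟩ := h44
  set C₁' : ℝ := max C₁ 0 with hC₁'
  set C₂' : ℝ := max C₂ 0 with hC₂'
  have hC₁'0 : 0 ≤ C₁' := le_max_right _ _
  have hC₂'0 : 0 ≤ C₂' := le_max_right _ _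
  set E : ℝ := ‖frake 1‖ + ‖frake 2‖ with hE
  have hE0 : 0 ≤ E := by positivity
  have hε4 : 0 < ε / 4 := by positivity
  -- the `𝔞`-constant: `𝔞 ≤ A₀𝓛⁴`, `A₀ = 16e⁹`
  set A₀ : ℝ := 16 * Real.exp 9 with hA₀
  have hA₀0 : 0 ≤ A₀ := by positivity
  set K : ℝ := C₁' * C₂' + C₁' with hK
  have hK0 : 0 ≤ K := by positivity
  obtain ⟨Dl, hDl⟩ := self_div_totient_le_norm_deriv_L_one
  obtain ⟨D₁, h₁⟩ := ((h1612 _ hε4).and hC₁).and hC₂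
  obtain ⟨D₂, h₂⟩ := exists_forall_le_ell
    (max 3 (max (32 * Real.exp 1 * K / ε) (4 * (C₂' * E * A₀) / ε)))
  refine ⟨max (max D₁ D₂) Dl, fun D _ χ hD hq hp hA p hpW => ?_⟩
  have hD1 : D₁ ≤ D := le_trans (le_trans (le_max_left _ _) (le_max_left _ _)) hD
  have hD2 : D₂ ≤ D := le_trans (le_trans (le_max_right _ _) (le_max_left _ _)) hD
  have hDl' : Dl ≤ D := le_trans (le_max_right _ _) hD
  obtain ⟨⟨e12, e16⟩, e44⟩ := h₁ D χ hD1 hq hp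
  have hM := h₂ D hD2
  have hℓ3 : 3 ≤ ell D := le_trans (le_max_left _ _) hM
  have hℓ1 : 1 ≤ ell D := by linarith
  have hℓK : 32 * Real.exp 1 * K / ε ≤ ell D := le_trans (le_trans (le_max_left _ _) (le_max_right _ _)) hM
  have hℓA : 4 * (C₂' * E * A₀) / ε ≤ ell D :=
    le_trans (le_trans (le_max_right _ _) (le_max_right _ _)) hM
  have hℓ0 : 0 < ell D := by linarith
  have hLge := hDl D χ hDl' hq hp hA
  -- `L′(1,χ) ≠ 0`
  have hρpos : 0 < (D : ℝ) / Nat.totient D := by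
    have := NeZero.pos D
    have hφ := Nat.totient_pos.mpr this
    positivity
  have hL0 : deriv χ.LFunction 1 ≠ 0 := by
    intro h
    rw [h, norm_zero, mul_zero] at hLge
    linarith
  have h1mem : (1 : ℕ) ∈ ({1, 2} : Finset ℕ) := by simp
  have h2mem : (2 : ℕ) ∈ ({1, 2} : Finset ℕ) := by simp
  -- the inputs at this `D, χ, p`
  have g12 := e12 hA p hpW
  rw [Finset.sum_pair (by norm_num : (1 : ℕ) ≠ 2)] at g12
  have hx4 : 0 ≤ (ell D ^ 4)⁻¹ := by positivity
  have g16₁ : ‖S D χ 1 - (frakA χ : ℂ) * frake 1 * ((Nat.totient D : ℂ) / (D : ℂ)) *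
      deriv χ.LFunction 1‖ ≤ C₁' * (ell D ^ 4)⁻¹ :=
    (e16 hA 1 h1mem).trans (mul_le_mul_of_nonneg_right (le_max_left _ _) hx4)
  have g16₂ : ‖S D χ 2 - (frakA χ : ℂ) * frake 2 * ((Nat.totient D : ℂ) / (D : ℂ)) *
      deriv χ.LFunction 1‖ ≤ C₁' * (ell D ^ 4)⁻¹ :=
    (e16 hA 2 h2mem).trans (mul_le_mul_of_nonneg_right (le_max_left _ _) hx4)
  -- the sharp u044 in the `C₂`-slot of `endgame_core`: `C₂𝓛⁻⁶ = (C₂𝓛⁻⁵)·𝓛⁻¹`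
  have hy : 0 ≤ (ell D ^ 6)⁻¹ * ‖deriv χ.LFunction 1‖⁻¹ := by positivity
  have hsplit : C₂' * (ell D ^ 6)⁻¹ * ‖deriv χ.LFunction 1‖⁻¹ =
      (C₂' * (ell D ^ 5)⁻¹) * (ell D)⁻¹ * ‖deriv χ.LFunction 1‖⁻¹ := by
    field_simp
  have hC₂''0 : 0 ≤ C₂' * (ell D ^ 5)⁻¹ := by positivity
  have g44₁ : ‖Rs D χ * R D χ 1 + 1 / deriv χ.LFunction 1‖ ≤
      (C₂' * (ell D ^ 5)⁻¹) * (ell D)⁻¹ * ‖deriv χ.LFunction 1‖⁻¹ := by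
    refine (e44 hA 1 h1mem).trans ?_
    rw [← hsplit, mul_assoc, mul_assoc C₂']
    exact mul_le_mul_of_nonneg_right (le_max_left _ _) hy
  have g44₂ : ‖Rs D χ * R D χ 2 + 1 / deriv χ.LFunction 1‖ ≤
      (C₂' * (ell D ^ 5)⁻¹) * (ell D)⁻¹ * ‖deriv χ.LFunction 1‖⁻¹ := by
    refine (e44 hA 2 h2mem).trans ?_
    rw [← hsplit, mul_assoc, mul_assoc C₂']
    exact mul_le_mul_of_nonneg_right (le_max_left _ _) hy
  -- `𝔞 ≤ (A₀𝓛³)·𝓛`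
  have hsm : frakA χ ≤ (A₀ * ell D ^ 3) * ell D := by
    have h := frakA_le χ (by simpa only [ell] using hℓ3) hp
    calc frakA χ ≤ 16 * Real.exp 9 * Real.log D ^ 4 := h
      _ = (A₀ * ell D ^ 3) * ell D := by rw [hA₀, ell]; ring
  have key := endgame_core (Φ := Φ D χ p) (Rs := Rs D χ) (e₁ := frake 1) (e₂ := frake 2) hL0
    (Nat.totient_pos.mpr (NeZero.pos D)) (NeZero.pos D) (frakA_nonneg χ) hC₁'0 hC₂''0 hℓ1 hLge
    hsm g12 g16₁ g16₂ g44₁ g44₂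
  refine key.trans (mul_le_mul_of_nonneg_right ?_ (Nat.cast_nonneg p))
  -- `ε/4 + 8e(C₁'C₂'𝓛⁻⁵ + C₁')𝓛⁻¹ + C₂'𝓛⁻⁵·E·A₀𝓛³ ≤ ε`
  have h5 : (ell D ^ 5)⁻¹ ≤ 1 := inv_le_one_of_one_le₀ (one_le_pow₀ hℓ1)
  have hmid : 8 * Real.exp 1 * (C₁' * (C₂' * (ell D ^ 5)⁻¹) + C₁') * (ell D)⁻¹ ≤ ε / 4 := by
    have hK' : C₁' * (C₂' * (ell D ^ 5)⁻¹) + C₁' ≤ K := by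
      rw [hK]
      have : C₁' * (C₂' * (ell D ^ 5)⁻¹) ≤ C₁' * (C₂' * 1) := by gcongr
      linarith
    calc 8 * Real.exp 1 * (C₁' * (C₂' * (ell D ^ 5)⁻¹) + C₁') * (ell D)⁻¹
        ≤ 8 * Real.exp 1 * K * (ell D)⁻¹ := by gcongr
      _ ≤ ε / 4 := by
          rw [← div_eq_mul_inv, div_le_iff₀ hℓ0]
          have : 32 * Real.exp 1 * K ≤ ell D * ε := by rwa [div_le_iff₀ hε] at hℓK
          linarith
  have hlast : C₂' * (ell D ^ 5)⁻¹ * (‖frake 1‖ + ‖frake 2‖) * (A₀ * ell D ^ 3) ≤ ε / 4 := by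
    rw [← hE]
    have hℓ2 : ell D ≤ ell D ^ 2 := by
      calc ell D = ell D ^ 1 := (pow_one _).symm
        _ ≤ ell D ^ 2 := pow_le_pow_right₀ hℓ1 (by norm_num)
    have hAE : 4 * (C₂' * E * A₀) ≤ ell D * ε := by rwa [div_le_iff₀ hε] at hℓA
    calc C₂' * (ell D ^ 5)⁻¹ * E * (A₀ * ell D ^ 3) = (C₂' * E * A₀) / ell D ^ 2 := by
          field_simp
      _ ≤ (C₂' * E * A₀) / ell D := div_le_div_of_nonneg_left (by positivity) hℓ0 hℓ2
      _ ≤ ε / 4 := by rw [div_le_iff₀ hℓ0]; linarith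
  linarith

variable (c' : ℝ)

/-- **`Z22:§16.u045` AS PRINTED from (16.12) and (16.16)** (§16 p. 95, tex L4682–L4685, "This together
with (16.16) and (16.12) yields `Φ₂(p) = −(𝔢₁+𝔢₂)𝔞p + o(p)`"): the typed node
`Typed.Section16B.Step16_u045 c′` follows from `Typed.Section16A.Eq16_12 c′` and
`Typed.Section16B.Eq16_16 c′` as typed, WITH NO FURTHER INPUT — `ℛ₂*ℛ₂ⱼ` at the computed rate
`ResidueValues.step16_u044_sharp`, Lemma 5.7 and `𝔞 ≤ 16e⁹𝓛⁴` being theorems of the tree. Compare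
`Skeleton.step16_u045_of`, which needs `𝔞 = o(𝓛)` (GAP-LEDGER G-d49-1; repair (a) executed here).
[cite: Zhang2022LandauSiegel, §16 p.95] -/
theorem step16_u045_of_eq16_12_eq16_16 (h1612 : Typed.Section16A.Eq16_12 c')
    (h1616 : Typed.Section16B.Eq16_16 c') : Typed.Section16B.Step16_u045 c' :=
  phi2p_eval_of_parts_sharp (fun _ _ χ p => Typed.Section16A.Phi2p c' χ p)
    (fun _ _ χ => Typed.Section16A.calR2star c' χ) (fun _ _ χ j => Typed.Section16A.calR2 c' χ j)
    (fun _ _ χ j => Typed.Section16A.calS2 c' χ j) h1612 h1616 (ResidueValues.step16_u044_sharp c')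

/-- **(16.17) from the §16 displays as printed** (§16 p. 95, tex L4682–L4687): (16.2) + (16.12) +
(16.16) ⇒ `Skeleton.Eval1617 c′` (absolute currency), u043/u044♯ and the in-line `(pt₀)^{β₁}` claim
being theorems of the tree — the edge `Skeleton.eval1617_of_section16` without its `hsmall`.
[cite: Zhang2022LandauSiegel, §16 (16.17) p.95] -/
theorem eval1617_of_eq16_2_eq16_12_eq16_16 (h162 : Typed.Section16A.Eq16_2 c')
    (h1612 : Typed.Section16A.Eq16_12 c') (h1616 : Typed.Section16B.Eq16_16 c') :
    Eval1617 c' :=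
  eval1617_of_eq16_2 c' h162 (step16_u045_of_eq16_12_eq16_16 c' h1612 h1616)

end Literature.NumberTheory.LFunctions.Zhang2022.Skeleton
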